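import Literature.RingTheory.MvPowerSeries.AdicTaylor
import Literature.RingTheory.MvPowerSeries.FrobeniusPowerBasis
import Mathlib.Data.Nat.Choose.Lucas
import Mathlib.Algebra.CharP.Basic
import HarnessLib

/-!
# Divided (Hasse) derivatives of power series in characteristic `p`: values on monomials and
# linearity over `p^N`-th powers

Topic: `Literature/RingTheory/MvPowerSeries`. For the divided partial derivatives
`Δ_α = hasseDeriv α` of `A⟦X_τ⟧` (`AdicTaylor.lean`: `coeff β (Δ_α f) = C(α+β, α) · f_{α+β}`):

* `hasseDeriv_monomial` — `Δ_α (c X^θ) = C(θ, α) c X^{θ−α}` if `α ≤ θ`, and `0` otherwise (any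
  commutative ring `A`); `hasseDeriv_one`, `hasseDeriv_C` (`Δ_α` kills constants for `α ≠ 0`).
* `choose_add_pow_mul_modEq` — Lucas periodicity: `C(b + p^N d, a) ≡ C(b, a) (mod p)` for `a < p^N`.
* `hasseDeriv_mul_of_isSupportedOnMultiples` — for `A` of prime characteristic `p`, `τ` finite and a
  multi-order `α` with `α_s < p^N` for every `s`: `Δ_α (u · g) = u · Δ_α g` whenever `u ∈ A⟦X^{p^N}⟧`
  (`IsSupportedOnMultiples (p^N) u`, `FrobeniusPowerBasis.lean`); hence `hasseDeriv_pow_mul`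
  (`Δ_α (f^{p^N} g) = f^{p^N} Δ_α g`) and `hasseDeriv_pow_eq_zero` (`Δ_α (f^{p^N}) = 0` for `α ≠ 0`):
  the divided derivatives of coordinatewise order `< p^N` are linear over the subring of `p^N`-th
  powers and annihilate its elements of positive degree in `α`.

## Source (read on the page) and what is proved here

C. Abad, *p-bases and differential operators on varieties defined over a non-perfect field*,
J. Algebra 523 (2019) = arXiv:1801.08458 [Abad2019pBases], §6 p. 13 (held text p0013): Lemma 6.2
(attributed there to Giraud) «Let k be a ring of characteristic p > 0, let A be an arbitrary
k-algebra, and let M be an A-module. If Δ : A → M is a differential operator of order n over k, then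
Δ is k[A^{p^e}]-linear for every p^e > n», and, for the Taylor operators of a polynomial ring,
«Tay^β(X^α) = binom(α, β) X^{α−β}» with the multi-index binomial «taking binom(α_λ, β_λ) = 0
whenever α_λ < β_λ». WHAT THIS FILE PROVES: the monomial formula for the POWER-SERIES divided
derivatives `hasseDeriv` of the tree (same formula, formal power series instead of polynomials), and
the instance of the linearity statement for these operators — `Δ_α` is linear over `p^N`-th powers as
soon as EVERY COORDINATE `α_s < p^N` (each one-variable factor of `Δ_α` has order `α_s`; the bound is
on coordinates, not on `|α|`) — by a direct coefficient computation (Lucas' theorem), not through the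
order filtration: we do NOT show here that `hasseDeriv α` is a differential operator of order
`≤ |α|` on `A⟦X⟧` in the sense of `Literature.AlgebraicGeometry.Resolution.IsDiffOpLE` (for polynomial
rings that is `Resolution.isDiffOpLE_hasseDeriv`; the abstract linearity lemma is
`Resolution.IsDiffOpLE.apply_pow_char_pow_mul`, `DiffOpFrobeniusLinear.lean`). Deliberately NOT
here: the Leibniz rule for `hasseDeriv` on power series.
-/

noncomputable section

open _root_.MvPowerSeries

namespace Literature.RingTheory.MvPowerSeries

universe u v

variable {τ : Type v} {A : Type u} [CommRing A]

/-! ## Values on monomials (any commutative ring) -/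

/-- **`Δ_α (c X^θ) = C(θ, α) · c X^{θ−α}`** for `α ≤ θ` and `Δ_α (c X^θ) = 0` otherwise — the power-
series form of «Tay^β(X^α) = binom(α, β) X^{α−β}» (multi-index binomial, zero when a coordinate of the
exponent is smaller than that of the order). The binomial is written as in `coeff_hasseDeriv`
(`Finsupp.prod` over the support of `θ`). [cite: Abad2019pBases, §6 p.13 (Tay^β(X^α) = binom(α,β) X^{α−β})] -/
theorem hasseDeriv_monomial [DecidableEq τ] (α θ : τ →₀ ℕ) (c : A) :
    hasseDeriv α (monomial θ c) =
      if α ≤ θ then monomial (θ - α) (((θ.prod fun s n => n.choose (α s) : ℕ) : A) * c) else 0 := by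
  classical
  ext β
  rw [coeff_hasseDeriv, coeff_monomial]
  split_ifs with h1 h2 h3
  · -- `α + β = θ`, `α ≤ θ`
    subst h1
    rw [coeff_monomial, if_pos (add_tsub_cancel_left α β).symm]
  · exact absurd le_self_add (h1 ▸ h2 :)
  · -- `α + β ≠ θ`, `α ≤ θ`
    rw [mul_zero, coeff_monomial, if_neg]
    intro hβ
    exact h1 (by rw [hβ, add_tsub_cancel_of_le h3])
  · rw [mul_zero, coeff_zero]

/-- `Δ_α 1 = 0` for `α ≠ 0` (and `Δ_0 1 = 1`). [cite: Abad2019pBases, §6 p.13 (Tay^β(X^α) = binom(α,β) X^{α−β})] -/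
theorem hasseDeriv_one [DecidableEq τ] {α : τ →₀ ℕ} (hα : α ≠ 0) :
    hasseDeriv α (1 : MvPowerSeries τ A) = 0 := by
  rw [show (1 : MvPowerSeries τ A) = monomial 0 1 from rfl, hasseDeriv_monomial, if_neg]
  exact fun h => hα (nonpos_iff_eq_zero.mp h)

/-- `Δ_α (C c) = 0` for `α ≠ 0`: divided derivatives of positive order kill constants.
[cite: Abad2019pBases, §6 p.13 (Tay^β(X^α) = binom(α,β) X^{α−β})] -/
theorem hasseDeriv_C [DecidableEq τ] {α : τ →₀ ℕ} (hα : α ≠ 0) (c : A) :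
    hasseDeriv α (C c : MvPowerSeries τ A) = 0 := by
  rw [show (C c : MvPowerSeries τ A) = monomial 0 c from rfl, hasseDeriv_monomial, if_neg]
  exact fun h => hα (nonpos_iff_eq_zero.mp h)

/-! ## Lucas periodicity of binomial coefficients -/

/-- **Lucas periodicity**: for a prime `p` and `a < p^N`, `C(b + p^N d, a) ≡ C(b, a) (mod p)` for all
`b, d` (iterate Lucas' theorem `C(n, k) ≡ C(n mod p, k mod p) · C(n / p, k / p)`; the base-`p` digits
of `a` above position `N` vanish). [cite: Abad2019pBases, Lemma 6.2 (arithmetic behind p^e-linearity)] -/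
theorem choose_add_pow_mul_modEq {p : ℕ} [hp : Fact p.Prime] :
    ∀ {N a : ℕ} (b d : ℕ), a < p ^ N → (b + p ^ N * d).choose a ≡ b.choose a [MOD p]
  | 0, a, b, d, ha => by
    have : a = 0 := by simpa using ha
    subst this
    simp [Nat.ModEq.refl]
  | N + 1, a, b, d, ha => by
    have hp0 : 0 < p := hp.out.pos
    have h1 := Choose.choose_modEq_choose_mod_mul_choose_div_nat (n := b + p ^ (N + 1) * d) (k := a)
      (p := p)
    have h2 := Choose.choose_modEq_choose_mod_mul_choose_div_nat (n := b) (k := a) (p := p)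
    have hmod : (b + p ^ (N + 1) * d) % p = b % p := by
      rw [pow_succ', mul_assoc, Nat.add_mul_mod_self_left]
    have hdiv : (b + p ^ (N + 1) * d) / p = b / p + p ^ N * d := by
      rw [pow_succ', mul_assoc, Nat.add_mul_div_left _ _ hp0]
    have ha' : a / p < p ^ N := by
      rw [Nat.div_lt_iff_lt_mul hp0]
      simpa [pow_succ] using ha
    have ih := choose_add_pow_mul_modEq (b / p) d ha'
    rw [hmod, hdiv] at h1
    exact (h1.trans ((ih.mul_left _).trans h2.symm))

/-! ## Linearity over `p^N`-th powers (prime characteristic `p`, finitely many variables) -/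

section Frobenius

variable (p : ℕ) [hp : Fact p.Prime] [CharP A p] [Fintype τ]

omit hp [CharP A p] in
/-- The binomial of `coeff_hasseDeriv` as a product over all indices of `C((α+β)_s, α_s)`. [folklore] -/
private theorem prod_choose_eq_prod_add (α β : τ →₀ ℕ) :
    ((α + β).prod fun s n => n.choose (α s)) = ∏ s, ((α + β) s).choose (α s) := by
  rw [prod_choose_eq]
  refine Finset.prod_congr rfl fun s _ => ?_
  rw [Finsupp.add_apply]

omit hp [CharP A p] in
/-- `∏_s C(j_s, α_s) = 0` unless `α ≤ j`. [folklore] -/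
private theorem prod_choose_eq_zero_of_not_le {α j : τ →₀ ℕ} (h : ¬ α ≤ j) :
    (∏ s, (j s).choose (α s)) = 0 := by
  obtain ⟨s, hs⟩ : ∃ s, j s < α s := by
    by_contra hcon
    push Not at hcon
    exact h fun s => hcon s
  exact Finset.prod_eq_zero (Finset.mem_univ s) (Nat.choose_eq_zero_of_lt hs)

omit [Fintype τ] in
/-- In characteristic `p`, `C(j + i, α) = C(j, α)` in `A` coordinatewise when `p^N ∣ i` and `α < p^N`.
[cite: Abad2019pBases, Lemma 6.2 (arithmetic behind p^e-linearity)] -/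
theorem natCast_choose_add_eq_of_dvd {N a j i : ℕ} (ha : a < p ^ N) (hi : p ^ N ∣ i) :
    (((j + i).choose a : ℕ) : A) = ((j.choose a : ℕ) : A) := by
  obtain ⟨d, rfl⟩ := hi
  exact CharP.natCast_eq_natCast' A p (choose_add_pow_mul_modEq j d ha)

/-- `∏_s C((i+j)_s, α_s) = ∏_s C(j_s, α_s)` in `A` when `p^N ∣ i` and `α < p^N` coordinatewise.
[cite: Abad2019pBases, Lemma 6.2 (arithmetic behind p^e-linearity)] -/
theorem natCast_prod_choose_add_eq_of_dvd {N : ℕ} {α : τ →₀ ℕ} (hα : ∀ s, α s < p ^ N)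
    {i : τ →₀ ℕ} (hi : ∀ s, p ^ N ∣ i s) (j : τ →₀ ℕ) :
    ((∏ s, ((i + j) s).choose (α s) : ℕ) : A) = ((∏ s, (j s).choose (α s) : ℕ) : A) := by
  rw [Nat.cast_prod, Nat.cast_prod]
  refine Finset.prod_congr rfl fun s _ => ?_
  rw [Finsupp.add_apply, add_comm]
  exact natCast_choose_add_eq_of_dvd p (hα s) (hi s)

variable [DecidableEq τ]

/-- **Divided derivatives of coordinatewise order `< p^N` are linear over `A⟦X^{p^N}⟧`**: if every
coordinate `α_s < p^N` and `u` is supported on `p^N ℕ^τ` (e.g. `u = f^{p^N}`), then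
`Δ_α (u · g) = u · Δ_α g` — the instance for the power-series operators `Δ_α` of «a differential
operator of order n … is k[A^{p^e}]-linear for every p^e > n» (applied to the one-variable factors of
`Δ_α`); proved on coefficients by Lucas periodicity. [cite: Abad2019pBases, Lemma 6.2] -/
theorem hasseDeriv_mul_of_isSupportedOnMultiples {N : ℕ} {α : τ →₀ ℕ} (hα : ∀ s, α s < p ^ N)
    {u : MvPowerSeries τ A} (hu : IsSupportedOnMultiples (p ^ N) u) (g : MvPowerSeries τ A) :
    hasseDeriv α (u * g) = u * hasseDeriv α g := by
  ext β
  -- the two coefficient expansions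
  rw [coeff_hasseDeriv, prod_choose_eq_prod_add, coeff_mul, coeff_mul, Finset.mul_sum]
  simp only [coeff_hasseDeriv, prod_choose_eq_prod_add]
  -- Step 1: termwise, the binomial at `α + β` may be replaced by the binomial at the second index.
  have step1 : ∀ x ∈ Finset.HasAntidiagonal.antidiagonal (α + β),
      ((∏ s, ((α + β) s).choose (α s) : ℕ) : A) * (coeff x.1 u * coeff x.2 g) =
        coeff x.1 u * (((∏ s, (x.2 s).choose (α s) : ℕ) : A) * coeff x.2 g) := by
    intro x hx
    rw [Finset.HasAntidiagonal.mem_antidiagonal] at hx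
    by_cases h1 : ∀ s, p ^ N ∣ x.1 s
    · rw [← hx, natCast_prod_choose_add_eq_of_dvd p hα h1 x.2]
      ring
    · push Not at h1
      rw [hu x.1 h1, zero_mul, zero_mul, mul_zero]
  rw [Finset.sum_congr rfl step1]
  -- Step 2: terms with `¬ α ≤ x.2` vanish; the rest is the image of `antidiagonal β` under
  -- `(i, k) ↦ (i, α + k)`.
  let e : (τ →₀ ℕ) × (τ →₀ ℕ) ↪ (τ →₀ ℕ) × (τ →₀ ℕ) :=
    ⟨fun y => (y.1, α + y.2), fun y y' h => by
      simp only [Prod.mk.injEq, add_right_inj] at h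
      exact Prod.ext h.1 h.2⟩
  have himage : (Finset.HasAntidiagonal.antidiagonal β).map e =
      (Finset.HasAntidiagonal.antidiagonal (α + β)).filter fun x => α ≤ x.2 := by
    ext x
    simp only [Finset.mem_map, Finset.HasAntidiagonal.mem_antidiagonal, Finset.mem_filter, Function.Embedding.coeFn_mk,
      e]
    constructor
    · rintro ⟨y, hy, rfl⟩
      exact ⟨by rw [← hy]; abel, le_self_add⟩
    · rintro ⟨hx, hle⟩
      refine ⟨(x.1, x.2 - α), ?_, ?_⟩
      · have : x.1 + (x.2 - α) + α = β + α := by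
          rw [add_assoc, tsub_add_cancel_of_le hle, hx, add_comm]
        exact add_right_cancel this
      · exact Prod.ext rfl (add_tsub_cancel_of_le hle)
  rw [← Finset.sum_filter_add_sum_filter_not (Finset.HasAntidiagonal.antidiagonal (α + β)) (fun x => α ≤ x.2),
    Finset.sum_eq_zero (s := (Finset.HasAntidiagonal.antidiagonal (α + β)).filter fun x => ¬ α ≤ x.2), add_zero,
    ← himage, Finset.sum_map]
  · rfl
  · intro x hx
    rw [Finset.mem_filter] at hx
    rw [prod_choose_eq_zero_of_not_le hx.2, Nat.cast_zero, zero_mul, mul_zero]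

/-- **`Δ_α (f^{p^N} · g) = f^{p^N} · Δ_α g`** when every coordinate `α_s < p^N` (prime characteristic `p`).
[cite: Abad2019pBases, Lemma 6.2] -/
theorem hasseDeriv_pow_mul {N : ℕ} {α : τ →₀ ℕ} (hα : ∀ s, α s < p ^ N) (f g : MvPowerSeries τ A) :
    hasseDeriv α (f ^ p ^ N * g) = f ^ p ^ N * hasseDeriv α g :=
  hasseDeriv_mul_of_isSupportedOnMultiples p hα (isSupportedOnMultiples_pow p f N) g

/-- **`Δ_α (f^{p^N}) = 0`** for `α ≠ 0` with every coordinate `α_s < p^N`: divided derivatives of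
positive coordinatewise order `< p^N` annihilate `p^N`-th powers. [cite: Abad2019pBases, Lemma 6.2] -/
theorem hasseDeriv_pow_eq_zero {N : ℕ} {α : τ →₀ ℕ} (hα : ∀ s, α s < p ^ N) (hα0 : α ≠ 0)
    (f : MvPowerSeries τ A) : hasseDeriv α (f ^ p ^ N) = 0 := by
  have h := hasseDeriv_pow_mul p hα f 1
  rwa [mul_one, hasseDeriv_one hα0, mul_zero] at h

/-- The same for any series supported on `p^N ℕ^τ`: `Δ_α u = 0` for `α ≠ 0` with coordinates `< p^N`.
[cite: Abad2019pBases, Lemma 6.2] -/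
theorem hasseDeriv_eq_zero_of_isSupportedOnMultiples {N : ℕ} {α : τ →₀ ℕ} (hα : ∀ s, α s < p ^ N)
    (hα0 : α ≠ 0) {u : MvPowerSeries τ A} (hu : IsSupportedOnMultiples (p ^ N) u) :
    hasseDeriv α u = 0 := by
  have h := hasseDeriv_mul_of_isSupportedOnMultiples p hα hu 1
  rwa [mul_one, hasseDeriv_one hα0, mul_zero] at h

end Frobenius

end Literature.RingTheory.MvPowerSeries

end
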